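import Mathlib.GroupTheory.DoubleCoset
import Literature.AnabelianGeometry.SemiGraphs.Coverticial
import Literature.AnabelianGeometry.SemiGraphs.ProperBranchLifting
import Literature.AnabelianGeometry.Anabelioids.ComponentsOrbits
import Literature.AnabelianGeometry.Anabelioids.ExactFunctorProofs
import Literature.AnabelianGeometry.Anabelioids.FiniteEtaleLocalDictionaryStabilizer
import Literature.AnabelianGeometry.Anabelioids.OrbitsDoubleCosets
import HarnessLib

/-!
# Branches of a finite étale covering over a branch: the COUNT half of the double-coset dictionary

Mochizuki, *Semi-graphs of anabelioids*, Publ. RIMS **42** (2006) 221–322, §2: Definition 2.2 (i)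
p. 23 ("edges of `𝔾'` that lie over an edge `e` correspond to connected components of `T_e`") and
Remark 2.2.1 p. 24 (images of `Π_v`, `Π_b` = stabilizers) [cite: MochizukiSemiAnbd2006, Def. 2.2(i) p.23].

PROOF-ONLY (abc-iut cell, L3 row G23 (d) step 2, abc-iut-L6-t17; the TWIST-INSENSITIVE half of
abc-iut-L3-t1's named fact `covering_branchFibre_doubleCosets`, valid under the LOCAL description
`Hom.IsFiniteEtaleCoveringOf` ALONE — no branch alignment, cf. findings L4t17-F1 / F-L6t17g3-1 and
ruling μ2): for a finite étale covering `φ : 𝒢' → 𝒢` attached to `A`, a vertex `v'` over `v`,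
basepoints `F'`, `F`, `β : φ_{v'}^* ⋙ F' ≅ F` (so `ι := Aut(β) ∘ π₁(φ_{v'}^*) : Π_{v'} → Π_v` has
image `Stab(s₀)` for the distinguished point `s₀ ∈ F(P)`, `P = cV v'`, abc-iut-L6-t17
`range_pi1Map_eq_stabilizer`), and a branch `b ∋ v` with representative `Π_b = Pb ⊆ Π_v`:

* `covering_branchFibre_doubleCosets_count` — there is `d₀ : {b' over b at v'} → Π_v` with
  `b' ↦ ι(Π_{v'})·d₀(b')·Π_b` BIJECTIVE onto `ι(Π_{v'}) \ Π_v / Π_b`.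

Route: `b'` ↦ its edge `e'` ↦ the component `cE e' ⊆ T_e` (which lies under `ψ_b(b^* P)` by the
position clause of the local description) ↦ the `Aut F_e`-orbit of its fibre image
(`ComponentsOrbits`) ↦ pulled back along the mono `b^*P ↪ b^*S_v ⥲ T_e` and transported by `α` to a
`Π_b`-orbit of `F(P) = Π_v · s₀` ↦ a double coset (`doubleCoset_mk_stabilizer_eq_iff`); injective by
`cE`-injectivity and `branchMap_injOn`, surjective by branch lifting over the PROPER base morphism
(`exists_branch_preimage_abuts`) plus `cV`-disjointness of distinct vertices over `v`.
The EQUALITY half (`ι(Π_{b'}) = ι(Π_{v'}) ∩ x Π_b x⁻¹` with `x` in the double coset of `b'`) needs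
`Hom.IsBranchAligned` (ruling μ2) and is proved separately.
-/

namespace Literature.AnabelianGeometry.SemiGraphs

open CategoryTheory CategoryTheory.Limits CategoryTheory.PreGaloisCategory
open Literature.AnabelianGeometry.Anabelioids
open scoped Pointwise

universe v₁ u₁ u

namespace SemiGraphOfAnabelioids

variable {𝒢 𝒢' : SemiGraphOfAnabelioids.{v₁, u₁, u}}

/-! ### Transport along equalities of edges and vertices -/

/-- `⟨e₁, h ▸ Q⟩ = ⟨e₂, Q⟩` in the Σ-type of edge components. [cite: MochizukiSemiAnbd2006, Def. 2.2(i) p.23] -/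
private theorem sigma_mk_eqRec_T (A : 𝒢.BObj) {e₁ e₂ : 𝒢.graph.Edge} (h : e₁ = e₂)
    (Q : π₀Obj (A.T e₂)) :
    (⟨e₁, (h ▸ Q : π₀Obj (A.T e₁))⟩ : Σ e, π₀Obj (A.T e)) = ⟨e₂, Q⟩ := by
  subst h
  rfl

/-- The position clause of `IsFiniteEtaleCoveringOf`, read at the home edge `e₁` as an inclusion of
fibre-images (cf. abc-iut-L6-d5, `FiniteEtaleCoveringConnectedProofs`).
[cite: MochizukiSemiAnbd2006, Def. 2.2(i) p.23] -/
private theorem range_subset_of_branchClause' (A : 𝒢.BObj) {e₁ e₂ : 𝒢.graph.Edge} (h : e₁ = e₂)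
    (F : 𝒢.E e₁ ⥤ FintypeCat.{v₁}) {X : 𝒢.E e₁} (g : X ⟶ A.T e₁) (Q : π₀Obj (A.T e₂))
    (f : (Q.1 : 𝒢.E e₂) ⟶ (𝒢.transportE h).obj X)
    (hf : f ≫ (𝒢.transportE h).map g ≫ eqToHom (𝒢.transportE_obj_T A h) = Q.1.arrow) :
    Set.range (F.map (h ▸ Q : π₀Obj (A.T e₁)).1.arrow) ⊆ Set.range (F.map g) := by
  subst h
  change f ≫ g ≫ eqToHom rfl = Q.1.arrow at hf
  rw [eqToHom_refl, Category.comp_id] at hf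
  change Set.range (F.map Q.1.arrow) ⊆ _
  rintro x ⟨q, rfl⟩
  refine ⟨F.map f q, ?_⟩
  have := congrArg (fun k => F.map k q) hf
  simp only [F.map_comp, FintypeCat.comp_apply] at this
  exact this

/-- The position clause at a branch `b'` of `𝒢'` over the branch `b` of `𝒢` (PRESENTED as `b`, by
`subst`): the component `cE(e')` of `T_e`, transported to the home edge `e = e(b)`, has fibre-image
inside that of `b^*(cV w) ↪ b^* S_v ⥲ T_e`, `w` the vertex of `b'`.
[cite: MochizukiSemiAnbd2006, Def. 2.2(i) p.23] -/
private theorem range_cE_subset (φ : Hom 𝒢' 𝒢) (A : 𝒢.BObj)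
    (cV : ∀ v' : 𝒢'.graph.Vertex, π₀Obj (A.S (φ.base.vertexMap v')))
    (cE : ∀ e' : 𝒢'.graph.Edge, π₀Obj (A.T (φ.base.edgeMap e')))
    (hbr : ∀ (b' : 𝒢'.graph.Branch) (v' : 𝒢'.graph.Vertex) (h' : 𝒢'.graph.abuts b' = some v'),
      ∃ f : ((cE (𝒢'.graph.edgeOf b')).1 : 𝒢.E (φ.base.edgeMap (𝒢'.graph.edgeOf b'))) ⟶
          (𝒢.transportE (φ.base.edgeOf_branchMap b')).obj
            ((𝒢.pull (φ.base.branchMap b') (φ.base.vertexMap v')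
              (φ.base.abuts_branchMap b' v' h')).pullback.obj ((cV v').1 : 𝒢.V (φ.base.vertexMap v'))),
        f ≫ (𝒢.transportE (φ.base.edgeOf_branchMap b')).map
              ((𝒢.pull _ _ (φ.base.abuts_branchMap b' v' h')).pullback.map (cV v').1.arrow ≫
                (A.ψ (φ.base.branchMap b') (φ.base.vertexMap v') (φ.base.abuts_branchMap b' v' h')).hom) ≫
            eqToHom (𝒢.transportE_obj_T A (φ.base.edgeOf_branchMap b')) =
          (cE (𝒢'.graph.edgeOf b')).1.arrow)
    (b' : 𝒢'.graph.Branch) (w : 𝒢'.graph.Vertex) (hw : 𝒢'.graph.abuts b' = some w)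
    (b : 𝒢.graph.Branch) (hb : φ.base.branchMap b' = b)
    (h : 𝒢.graph.abuts b = some (φ.base.vertexMap w))
    (Fe : 𝒢.E (𝒢.graph.edgeOf b) ⥤ FintypeCat.{v₁})
    (he : 𝒢.graph.edgeOf b = φ.base.edgeMap (𝒢'.graph.edgeOf b')) :
    Set.range (Fe.map (he ▸ cE (𝒢'.graph.edgeOf b') : π₀Obj (A.T (𝒢.graph.edgeOf b))).1.arrow) ⊆
      Set.range (Fe.map ((𝒢.pull b _ h).pullback.map (cV w).1.arrow ≫ (A.ψ b _ h).hom)) := by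
  subst hb
  obtain ⟨f, hf⟩ := hbr b' w hw
  exact range_subset_of_branchClause' A (φ.base.edgeOf_branchMap b') Fe _ (cE _) f hf

/-- Two vertex components `P₁ ⊆ S_{u₁}`, `P₂ ⊆ S_{u₂}` over (propositionally) equal vertices whose
images `ψ_b(b^* Pᵢ) ⊆ T_e` have a common point of the fibre coincide (as points of `Σ v, π₀(S_v)`):
distinct connected components have disjoint fibre-images, for the basepoint `b^* ⋙ F_e` of `𝒢_u`.
[cite: MochizukiSemiAnbd2006, Def. 2.2(i) p.23] -/
private theorem sigma_component_eq_of_mem_range (A : 𝒢.BObj) (b : 𝒢.graph.Branch)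
    {u₁ u₂ : 𝒢.graph.Vertex} (hu : u₁ = u₂) (h₁ : 𝒢.graph.abuts b = some u₁)
    (h₂ : 𝒢.graph.abuts b = some u₂) (P₁ : π₀Obj (A.S u₁)) (P₂ : π₀Obj (A.S u₂))
    (Fe : 𝒢.E (𝒢.graph.edgeOf b) ⥤ FintypeCat.{v₁}) [FiberFunctor Fe]
    (z : Fe.obj (A.T (𝒢.graph.edgeOf b)))
    (hz₁ : z ∈ Set.range (Fe.map ((𝒢.pull b u₁ h₁).pullback.map P₁.1.arrow ≫ (A.ψ b u₁ h₁).hom)))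
    (hz₂ : z ∈ Set.range (Fe.map ((𝒢.pull b u₂ h₂).pullback.map P₂.1.arrow ≫ (A.ψ b u₂ h₂).hom))) :
    (⟨u₁, P₁⟩ : Σ v, π₀Obj (A.S v)) = ⟨u₂, P₂⟩ := by
  subst hu
  let F'' : 𝒢.V u₁ ⥤ FintypeCat.{v₁} := (𝒢.pull b u₁ h₁).pullback ⋙ Fe
  haveI : FiberFunctor F'' := fiberFunctor_comp_of_exact _ _
  have key : ∀ P : π₀Obj (A.S u₁),
      z ∈ Set.range (Fe.map ((𝒢.pull b u₁ h₁).pullback.map P.1.arrow ≫ (A.ψ b u₁ h₁).hom)) →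
        Fe.map (A.ψ b u₁ h₁).inv z ∈ Set.range (F''.map P.1.arrow) := by
    rintro P ⟨y, rfl⟩
    refine ⟨y, ?_⟩
    change Fe.map _ y = Fe.map _ (Fe.map _ y)
    rw [← FintypeCat.comp_apply, ← Fe.map_comp, Category.assoc, Iso.hom_inv_id, Category.comp_id]
  rw [component_eq_of_mem_range F'' P₁ P₂ (key P₁ hz₁) (key P₂ hz₂)]

/-! ### The count -/

/-- **Branches over `b` at `v'` ↔ double cosets `ι(Π_{v'}) \ Π_v / Π_b` — the COUNT** (twist-
insensitive half of `covering_branchFibre_doubleCosets`, under `Hom.IsFiniteEtaleCoveringOf` alone):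
there is `d₀ : {b' over b at v'} → Π_v = Aut F` such that `b' ↦ ι(Π_{v'})·d₀(b')·Π_b` is a
bijection onto the double-coset space, where `ι = Aut(β) ∘ π₁(φ_{v'}^*)` and
`Π_b = 𝒢.branchSubgroup F b h F_e α`.  (`d₀(b')⁻¹ · s₀` is a point of `F(P)` lying, via `α` and
`ψ_b`, over the component `cE(e(b'))` of `T_e`.) [cite: MochizukiSemiAnbd2006, Def. 2.2(i) p.23] -/
theorem covering_branchFibre_doubleCosets_count (φ : Hom 𝒢' 𝒢) (A : 𝒢.BObj)
    (hφ : φ.IsFiniteEtaleCoveringOf A)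
    (v' : 𝒢'.graph.Vertex) (F' : 𝒢'.V v' ⥤ FintypeCat.{v₁}) [FiberFunctor F']
    (F : 𝒢.V (φ.base.vertexMap v') ⥤ FintypeCat.{v₁}) [FiberFunctor F]
    (β : (φ.φV v').pullback ⋙ F' ≅ F)
    (b : 𝒢.graph.Branch) (h : 𝒢.graph.abuts b = some (φ.base.vertexMap v'))
    (Fe : 𝒢.E (𝒢.graph.edgeOf b) ⥤ FintypeCat.{v₁}) [FiberFunctor Fe]
    (α : (𝒢.pull b _ h).pullback ⋙ Fe ≅ F) :
    ∃ d₀ : {b' : 𝒢'.graph.Branch // φ.base.branchMap b' = b ∧ 𝒢'.graph.abuts b' = some v'} → Aut F,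
      Function.Bijective (fun b' => DoubleCoset.mk
        ((Aut.autMulEquivOfIso β).toMonoidHom.comp (pi1Map (φ.φV v').pullback F')).range
        (𝒢.branchSubgroup F b h Fe α) (d₀ b')) := by
  classical
  obtain ⟨hprop, cV, cE, hVbij, hEbij, hVloc, -, hbr⟩ := hφ
  -- the vertex component `P = cV v'`, the local chart and the distinguished point `s₀ ∈ F(P)`
  haveI : PreGaloisCategory.IsConnected ((cV v').1 : 𝒢.V (φ.base.vertexMap v')) := (cV v').2
  obtain ⟨αV, hαV, ⟨ζ⟩⟩ := hVloc v'
  haveI := hαV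
  have hT : IsTerminal (αV.obj (Over.mk (𝟙 ((cV v').1 : 𝒢.V (φ.base.vertexMap v'))))) :=
    Over.mkIdTerminal.isTerminalObj αV _
  obtain ⟨eT⟩ := nonempty_equiv_fiber_terminal_punit F'
  let t : F'.obj (αV.obj (Over.mk (𝟙 _))) := F'.map (hT.from (⊤_ 𝒢'.V v')) (eT.symm PUnit.unit)
  let s₀ : F.obj ((cV v').1 : 𝒢.V (φ.base.vertexMap v')) := β.hom.app _
    (F'.map (αV.map ((Over.forgetAdjStar _).unit.app (Over.mk (𝟙 _))) ≫ ζ.inv.app _) t)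
  have hι : ((Aut.autMulEquivOfIso β).toMonoidHom.comp (pi1Map (φ.φV v').pullback F')).range =
      MulAction.stabilizer (Aut F) s₀ :=
    range_pi1Map_eq_stabilizer αV ζ F' β t
  rw [hι]
  -- the mono `m : b^* P ↪ b^* S_v ⥲ T_e` and its (injective) fibre map
  let m : (𝒢.pull b _ h).pullback.obj ((cV v').1 : 𝒢.V (φ.base.vertexMap v')) ⟶
      A.T (𝒢.graph.edgeOf b) :=
    (𝒢.pull b _ h).pullback.map (cV v').1.arrow ≫ (A.ψ b _ h).hom
  haveI : Mono m := mono_comp _ _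
  have hm : Function.Injective (Fe.map m) :=
    ConcreteCategory.injective_of_mono_of_preservesPullback (Fe.map m)
  -- abbreviations for the branches over `b` at `v'`
  let B' := {b' : 𝒢'.graph.Branch // φ.base.branchMap b' = b ∧ 𝒢'.graph.abuts b' = some v'}
  have he : ∀ b' : B', 𝒢.graph.edgeOf b = φ.base.edgeMap (𝒢'.graph.edgeOf b'.1) := fun b' => by
    have h1 := φ.base.edgeOf_branchMap b'.1
    rw [b'.2.1] at h1
    exact h1
  let R : B' → π₀Obj (A.T (𝒢.graph.edgeOf b)) := fun b' => (he b') ▸ cE (𝒢'.graph.edgeOf b'.1)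
  have hRsub : ∀ b' : B', Set.range (Fe.map (R b').1.arrow) ⊆ Set.range (Fe.map m) := fun b' =>
    range_cE_subset φ A cV cE hbr b'.1 v' b'.2.2 b b'.2.1 h Fe (he b')
  have hRinj : Function.Injective R := by
    intro b₁ b₂ hR
    have hS : (⟨φ.base.edgeMap (𝒢'.graph.edgeOf b₁.1), cE (𝒢'.graph.edgeOf b₁.1)⟩ :
        Σ e, π₀Obj (A.T e)) = ⟨φ.base.edgeMap (𝒢'.graph.edgeOf b₂.1), cE (𝒢'.graph.edgeOf b₂.1)⟩ := by
      rw [← sigma_mk_eqRec_T A (he b₁), ← sigma_mk_eqRec_T A (he b₂)]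
      exact congrArg _ hR
    have hee : 𝒢'.graph.edgeOf b₁.1 = 𝒢'.graph.edgeOf b₂.1 := hEbij.1 hS
    exact Subtype.ext (φ.base.branchMap_injOn _ _ hee (b₁.2.1.trans b₂.2.1.symm))
  -- a point of `b^* P` over each component `R b'`
  have hpt : ∀ b' : B', ∃ q : Fe.obj ((𝒢.pull b _ h).pullback.obj ((cV v').1 : 𝒢.V _)),
      Fe.map m q ∈ Set.range (Fe.map (R b').1.arrow) := fun b' => by
    haveI : PreGaloisCategory.IsConnected ((R b').1 : 𝒢.E (𝒢.graph.edgeOf b)) := (R b').2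
    obtain ⟨r⟩ := nonempty_fiber_of_isConnected Fe ((R b').1 : 𝒢.E (𝒢.graph.edgeOf b))
    obtain ⟨q, hq⟩ := hRsub b' ⟨r, rfl⟩
    exact ⟨q, hq ▸ ⟨r, rfl⟩⟩
  choose q hq using hpt
  -- `d₀(b')⁻¹ · s₀ := α(q b')`, using transitivity of `Π_v` on `F(P)`
  have hd : ∀ b' : B', ∃ x : Aut F, x⁻¹ • s₀ = α.hom.app _ (q b') := fun b' => by
    obtain ⟨g, hg⟩ := MulAction.exists_smul_eq (Aut F) s₀ (α.hom.app _ (q b'))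
    exact ⟨g⁻¹, by rw [inv_inv]; exact hg⟩
  choose d₀ hd₀ using hd
  refine ⟨d₀, fun b₁ b₂ h12 => ?_, fun c => ?_⟩
  · -- injective
    apply hRinj
    have h1 : (d₀ b₂)⁻¹ • s₀ ∈ MulAction.orbit (𝒢.branchSubgroup F b h Fe α) ((d₀ b₁)⁻¹ • s₀) :=
      (doubleCoset_mk_stabilizer_eq_iff s₀ _ (d₀ b₁) (d₀ b₂)).mp h12
    rw [hd₀, hd₀] at h1
    have h2 : q b₂ ∈ MulAction.orbit (Aut Fe) (q b₁) :=
      (mem_orbit_range_iff_of_transport _ Fe α _ (q b₁) (q b₂)).mp h1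
    have h3 : Fe.map m (q b₂) ∈ MulAction.orbit (Aut Fe) (Fe.map m (q b₁)) :=
      map_mem_orbit_of_mem_orbit Fe m _ _ h2
    rw [← range_map_arrow_eq_orbit Fe (R b₁) (hq b₁)] at h3
    exact component_eq_of_mem_range Fe (R b₁) (R b₂) h3 (hq b₂)
  · -- surjective
    induction c using Quotient.inductionOn with
    | h x =>
    -- the point `x⁻¹ s₀ ∈ F(P)`, moved to `T_e`, and its component
    let y : Fe.obj ((𝒢.pull b _ h).pullback.obj ((cV v').1 : 𝒢.V _)) := α.inv.app _ (x⁻¹ • s₀)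
    have hy : α.hom.app _ y = x⁻¹ • s₀ := by
      have h1 := ConcreteCategory.congr_hom (α.inv_hom_id_app ((cV v').1 : 𝒢.V _)) (x⁻¹ • s₀)
      simp only [FintypeCat.comp_apply, FintypeCat.id_apply] at h1
      exact h1
    obtain ⟨R₀, hR₀⟩ := exists_component_mem_range Fe (Fe.map m y)
    -- the edge `e''` of `𝔾'` over `e` with `cE e'' = R₀`, and its branch over `b`
    obtain ⟨e'', he''⟩ := hEbij.2 ⟨𝒢.graph.edgeOf b, R₀⟩
    have he''e : φ.base.edgeMap e'' = 𝒢.graph.edgeOf b := congrArg Sigma.fst he''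
    obtain ⟨b'', w, hb''e, hb''b, hw, hwv⟩ :=
      SemiGraph.exists_branch_preimage_abuts φ.base hprop e'' b he''e.symm _ h
    subst hb''e
    -- `w = v'`: the component of `S_v` under `w` meets `P = cV v'` (via `ψ_b`)
    have hew : 𝒢.graph.edgeOf b = φ.base.edgeMap (𝒢'.graph.edgeOf b'') := he''e.symm
    have hRw : (hew ▸ cE (𝒢'.graph.edgeOf b'') : π₀Obj (A.T (𝒢.graph.edgeOf b))) = R₀ :=
      eq_of_heq (Sigma.mk.inj_iff.mp ((sigma_mk_eqRec_T A hew (cE _)).trans he'')).2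
    have hw' : w = v' := by
      have hsub := range_cE_subset φ A cV cE hbr b'' w hw b hb''b (hwv.symm ▸ h) Fe hew
      rw [hRw] at hsub
      exact hVbij.1 (sigma_component_eq_of_mem_range A b hwv (hwv.symm ▸ h) h (cV w) (cV v') Fe
        (Fe.map m y) (hsub hR₀) ⟨y, rfl⟩)
    subst hw'
    refine ⟨⟨b'', hb''b, hw⟩, ?_⟩
    -- `d₀ b''` and `x` define the same double coset: both points lie over the component `R₀`
    change DoubleCoset.mk _ _ (d₀ ⟨b'', hb''b, hw⟩) = DoubleCoset.mk _ _ x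
    apply doubleCoset_mk_stabilizer_eq_of_inv_smul
    rw [hd₀, ← hy]
    refine (mem_orbit_range_iff_of_transport _ Fe α _ y (q ⟨b'', hb''b, hw⟩)).mpr ?_
    refine mem_orbit_of_map_mem_orbit Fe m hm _ _ ?_
    have hRb'' : R ⟨b'', hb''b, hw⟩ = R₀ := hRw
    rw [← range_map_arrow_eq_orbit Fe R₀ hR₀, ← hRb'']
    exact hq _

end SemiGraphOfAnabelioids

end Literature.AnabelianGeometry.SemiGraphs
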